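/-
Copyright: the m5 harness (cell B2b-5 `b2b-lgcu-borel`, generation 21).  Sorry-free; axioms: propext,
Classical.choice, Quot.sound.  VALUE = THEOREM (a 2-member, budget-free exclusion on the level-one
slice), NOT summit progress: the crux `SubgroupIdentityDesigns` is untouched.
-/
import Mathlib
import Summits.MatrixMultiplication.MatrixMultiplication.Theorems.SubgroupIdentityDesigns.Negative.ProductObstruction

/-!
# Transvection pair exclusion: no two adjacent members contain full centre-transvection groups

The strongest instance so far of the separation exclusions of `ProductObstruction`, and the first
one acting on `p`-subgroups (where determinant characters see nothing).

For a line `ℓ = 𝔽_p e` of `V = 𝔽_p^m` let `T(ℓ) = {1 + e ⊗ φ : φ ∈ V^*, φ(e) = 0}` be the group of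
ALL transvections with centre `ℓ` (elementary abelian of order `p^{m-1}`; `(1 + e ⊗ φ) v =
v + φ(v) e`).  Its characters are `σ_c(1 + e ⊗ φ) = ψ(φ(c))` (`c ∈ V/ℓ`, `ψ` the standard
additive character of `𝔽_p`), the stabiliser of `w` is `{φ : φ(e) = φ(w) = 0}`, and `σ_c` is
trivial on it iff `c ∈ ⟨e, w⟩`; so the ADMISSIBLE SET of `σ_c` (`c ∉ ℓ`) is the punctured plane
`⟨e, c⟩ ∖ ℓ`.  For two lines `ℓ₁ ≠ ℓ₂` and `m ≥ 3` choose `c₂ ∈ ℓ₁` and `c₁ ∉ ℓ₁ + ℓ₂`: the planes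
`⟨e₁, c₁⟩` and `⟨e₂, c₂⟩ = ℓ₁ + ℓ₂` meet exactly in `ℓ₁`, which the first admissible set omits —
the two admissible sets are DISJOINT.  By `ProductObstruction.no_design_of_disjoint₁₂` (applied to
the sub-triple `(T(ℓ₁), T(ℓ₂), H₃)`, to which the TPP and any design restrict):

**THEOREM (every `p`, every `m ≥ 3`, every exponent).**  In a subgroup-TPP triple carrying a
level-one identity design, no two ADJACENT members `H₁, H₂` (or `H₂, H₃`) contain full
centre-transvection groups `T(ℓ₁)`, `T(ℓ₂)`.  (`ℓ₁ = ℓ₂` is already excluded by the TPP, which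
forces `H₁ ∩ H₂ = 1`.)

Here in coordinates (`ℓ₁ = 𝔽_p e_{i₀}`, `ℓ₂ = 𝔽_p e_{i₁}`, a third index `i₂`; general pairs of
lines by one simultaneous conjugation of the triple):

* `translGroup i₀` — `T(𝔽_p e_{i₀})` as a subgroup of `GL_m(𝔽_p)`; `transl` its elements;
* `trChar i₀ c` — the character `σ_c`; `adm_test` — an admissible vector `u` of `σ_c` satisfies
  `φ(u) = 0 ⇒ φ(c) = 0` for every functional `φ` with `φ(e_{i₀}) = 0`;
* `disjoint_adm_transl` — the two admissible sets above are disjoint (`i₀, i₁, i₂` distinct);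
* `no_design_of_transl₁₂`, `no_design_of_transl₂₃` — the exclusions.

WHY NEW.  `|T(ℓ)| = p^{m-1}` is far below every counting threshold (`b = (p^m − 1)/(p − 1)`), `T(ℓ)`
itself carries a level-one delta (every `σ_c` is admissible), it lies in `SL_m` (no determinant
test applies), and single-member laws constrain one member at a time: the exclusion is invisible to
all earlier files.  Sanity data (`code/g21/transl_check.py`, exact rank): the pair
`(T(e₀), T(e₁))` with trivial third member carries no level-one design for `(p,m) = (2,3), (3,3),
(5,3), (2,4), (3,4)`, and DOES carry one for `m = 2` (`p = 3, 5, 7`), where the argument needs the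
missing third index.  Honest scope: a constraint on pairs of members; it empties no `(m,1,p)` cell
by itself (`run/shared/lean/b2b/levelgraded-cu/ORACLE-g21.md` §G21-13).
-/

noncomputable section

open scoped BigOperators Classical Matrix

namespace Summit.MatrixMultiplication.MatrixMultiplication.Theorems.SubgroupIdentityDesigns.Negative
namespace TransvectionPair

open Literature.Barriers.MatrixMultiplication (SubgroupTPP)
open Summit.MatrixMultiplication.MatrixMultiplication.Theorems.LieRankDesigns.Negative (GLm Mat)
open Summit.MatrixMultiplication.MatrixMultiplication.Theorems.LevelOneGL2Designs.Negative
open LevelOneEquivariantDim (adm mem_adm smul_mem_adm)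
open ProductObstruction (no_design_of_disjoint₁₂ no_design_of_disjoint₂₃)

variable {p m : ℕ} [hp : Fact p.Prime]

section Transvections

variable (i₀ : Fin m)

/-- The nilpotent part `e_{i₀} ⊗ φ` of a transvection with centre `𝔽_p e_{i₀}`. -/
def nil (φ : Fin m → ZMod p) : Mat p m := Matrix.vecMulVec (Pi.single i₀ 1) φ

/-- Entries of `e_{i₀} ⊗ φ`. -/
theorem nil_apply (φ : Fin m → ZMod p) (i j : Fin m) :
    nil i₀ φ i j = if i = i₀ then φ j else 0 := by
  rw [nil, Matrix.vecMulVec_apply, Pi.single_apply]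
  split_ifs <;> simp

/-- `(e_{i₀} ⊗ φ) v = φ(v) e_{i₀}`. -/
theorem nil_mulVec (φ v : Fin m → ZMod p) :
    nil i₀ φ *ᵥ v = (φ ⬝ᵥ v) • Pi.single i₀ (1 : ZMod p) := by
  funext i
  simp only [Matrix.mulVec, dotProduct, nil_apply, Pi.smul_apply, Pi.single_apply, smul_eq_mul,
    mul_ite, mul_one, mul_zero]
  split_ifs with h
  · rfl
  · simp

/-- `e_{i₀} ⊗ φ` is additive in `φ`. -/
theorem nil_add (φ φ' : Fin m → ZMod p) : nil i₀ (φ + φ') = nil i₀ φ + nil i₀ φ' := by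
  ext i j
  simp only [nil_apply, Matrix.add_apply, Pi.add_apply]
  split_ifs <;> simp

/-- `e_{i₀} ⊗ 0 = 0`. -/
theorem nil_zero : nil i₀ (0 : Fin m → ZMod p) = 0 := by
  ext i j
  simp [nil_apply]

/-- `(e ⊗ φ)(e ⊗ φ') = φ(e) · (e ⊗ φ') = 0` when `φ(e_{i₀}) = 0`. -/
theorem nil_mul_nil {φ : Fin m → ZMod p} (hφ : φ i₀ = 0) (φ' : Fin m → ZMod p) :
    nil i₀ φ * nil i₀ φ' = 0 := by
  ext i j
  simp only [Matrix.mul_apply, nil_apply, Matrix.zero_apply]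
  split_ifs with h
  · rw [Finset.sum_eq_single i₀ (fun k _ hk => by rw [if_neg hk, mul_zero])
      (fun h => (h (Finset.mem_univ _)).elim), if_pos rfl, hφ, zero_mul]
  · simp

/-- `(1 + e ⊗ φ)(1 + e ⊗ φ') = 1 + e ⊗ (φ + φ')` when `φ(e_{i₀}) = 0`. -/
theorem one_add_nil_mul {φ : Fin m → ZMod p} (hφ : φ i₀ = 0) (φ' : Fin m → ZMod p) :
    (1 + nil i₀ φ) * (1 + nil i₀ φ') = 1 + nil i₀ (φ + φ') := by
  rw [add_mul, mul_add, mul_add, one_mul, mul_one, one_mul, nil_mul_nil i₀ hφ, add_zero, nil_add,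
    add_assoc, add_comm (nil i₀ φ')]

/-- The transvection `1 + e_{i₀} ⊗ φ` (`φ(e_{i₀}) = 0`) as an element of `GL_m(𝔽_p)`, with inverse
`1 − e_{i₀} ⊗ φ`. -/
def transl (φ : Fin m → ZMod p) (hφ : φ i₀ = 0) : GLm p m where
  val := 1 + nil i₀ φ
  inv := 1 + nil i₀ (-φ)
  val_inv := by rw [one_add_nil_mul i₀ hφ, add_neg_cancel, nil_zero, add_zero]
  inv_val := by
    rw [one_add_nil_mul i₀ (show (-φ) i₀ = 0 by rw [Pi.neg_apply, hφ, neg_zero]), neg_add_cancel,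
      nil_zero, add_zero]

/-- Underlying matrix of `transl`. -/
theorem coe_transl (φ : Fin m → ZMod p) (hφ : φ i₀ = 0) :
    ((transl i₀ φ hφ : GLm p m) : Mat p m) = 1 + nil i₀ φ := rfl

/-- `(1 + e ⊗ φ) v = v + φ(v) e`. -/
theorem transl_smul (φ : Fin m → ZMod p) (hφ : φ i₀ = 0) (v : Fin m → ZMod p) :
    transl i₀ φ hφ • v = v + (φ ⬝ᵥ v) • Pi.single i₀ (1 : ZMod p) := by
  show ((transl i₀ φ hφ : GLm p m) : Mat p m) *ᵥ v = _
  rw [coe_transl, Matrix.add_mulVec, Matrix.one_mulVec, nil_mulVec]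

/-- A transvection fixes the vectors its functional kills. -/
theorem transl_smul_of_eq_zero (φ : Fin m → ZMod p) (hφ : φ i₀ = 0) {v : Fin m → ZMod p}
    (hv : φ ⬝ᵥ v = 0) : transl i₀ φ hφ • v = v := by
  rw [transl_smul, hv, zero_smul, add_zero]

/-- **The full centre-transvection group** `T(𝔽_p e_{i₀}) = {1 + e_{i₀} ⊗ φ : φ(e_{i₀}) = 0}`. -/
def translGroup : Subgroup (GLm p m) where
  carrier := {k | ∃ φ : Fin m → ZMod p, φ i₀ = 0 ∧ ((k : GLm p m) : Mat p m) = 1 + nil i₀ φ}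
  one_mem' := ⟨0, rfl, by rw [nil_zero, add_zero]; rfl⟩
  mul_mem' := by
    rintro a b ⟨φ, hφ, ha⟩ ⟨φ', hφ', hb⟩
    refine ⟨φ + φ', by rw [Pi.add_apply, hφ, hφ', add_zero], ?_⟩
    rw [Units.val_mul, ha, hb, one_add_nil_mul i₀ hφ]
  inv_mem' := by
    rintro a ⟨φ, hφ, ha⟩
    refine ⟨-φ, by rw [Pi.neg_apply, hφ, neg_zero], ?_⟩
    have h : (a : Mat p m) * (1 + nil i₀ (-φ)) = 1 := by
      rw [ha, one_add_nil_mul i₀ hφ, add_neg_cancel, nil_zero, add_zero]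
    calc ((a⁻¹ : GLm p m) : Mat p m) = (a⁻¹ : GLm p m) * ((a : Mat p m) * (1 + nil i₀ (-φ))) := by
          rw [h, mul_one]
      _ = 1 + nil i₀ (-φ) := by rw [← mul_assoc, Units.inv_mul, one_mul]

/-- `transl i₀ φ ∈ T(𝔽_p e_{i₀})`. -/
theorem transl_mem (φ : Fin m → ZMod p) (hφ : φ i₀ = 0) : transl i₀ φ hφ ∈ translGroup i₀ :=
  ⟨φ, hφ, rfl⟩

/-- The additive parameter `τ_c(k) = ((k − 1) c)_{i₀}` (`= φ(c)` for `k = 1 + e_{i₀} ⊗ φ`). -/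
def tau (c : Fin m → ZMod p) (k : translGroup (p := p) i₀) : ZMod p :=
  (((k : GLm p m) : Mat p m) *ᵥ c) i₀ - c i₀

/-- `τ_c(1 + e ⊗ φ) = φ(c)`. -/
theorem tau_eq (c : Fin m → ZMod p) {k : translGroup (p := p) i₀} {φ : Fin m → ZMod p}
    (hk : ((k : GLm p m) : Mat p m) = 1 + nil i₀ φ) : tau i₀ c k = φ ⬝ᵥ c := by
  rw [tau, hk, Matrix.add_mulVec, Matrix.one_mulVec, nil_mulVec, Pi.add_apply, Pi.smul_apply,
    Pi.single_eq_same, smul_eq_mul, mul_one, add_sub_cancel_left]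

/-- `τ_c` is additive. -/
theorem tau_mul (c : Fin m → ZMod p) (k k' : translGroup (p := p) i₀) :
    tau i₀ c (k * k') = tau i₀ c k + tau i₀ c k' := by
  obtain ⟨φ, hφ, hk⟩ := k.2
  obtain ⟨φ', hφ', hk'⟩ := k'.2
  have hkk' : (((k * k' : translGroup i₀) : GLm p m) : Mat p m) = 1 + nil i₀ (φ + φ') := by
    rw [Subgroup.coe_mul, Units.val_mul, hk, hk', one_add_nil_mul i₀ hφ]
  rw [tau_eq i₀ c hkk', tau_eq i₀ c hk, tau_eq i₀ c hk', add_dotProduct]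

/-- `τ_c(1) = 0`. -/
theorem tau_one (c : Fin m → ZMod p) : tau i₀ c (1 : translGroup (p := p) i₀) = 0 := by
  rw [tau, Subgroup.coe_one, Units.val_one, Matrix.one_mulVec, sub_self]

/-- **The character `σ_c` of `T(𝔽_p e_{i₀})`**: `σ_c(1 + e ⊗ φ) = ψ(φ(c))`, `ψ` the standard
additive character of `𝔽_p`. -/
def trChar (c : Fin m → ZMod p) : translGroup (p := p) i₀ →* ℂˣ where
  toFun k := ⟨ZMod.stdAddChar (tau i₀ c k), ZMod.stdAddChar (-(tau i₀ c k)),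
    by rw [← AddChar.map_add_eq_mul, add_neg_cancel, AddChar.map_zero_eq_one],
    by rw [← AddChar.map_add_eq_mul, neg_add_cancel, AddChar.map_zero_eq_one]⟩
  map_one' := Units.ext (by
    show (ZMod.stdAddChar (tau i₀ c 1) : ℂ) = 1
    rw [tau_one, AddChar.map_zero_eq_one])
  map_mul' k k' := Units.ext (by
    show (ZMod.stdAddChar (tau i₀ c (k * k')) : ℂ) =
      ZMod.stdAddChar (tau i₀ c k) * ZMod.stdAddChar (tau i₀ c k')
    rw [tau_mul, AddChar.map_add_eq_mul])

/-- Value of `σ_c`. -/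
theorem coe_trChar (c : Fin m → ZMod p) (k : translGroup (p := p) i₀) :
    ((trChar i₀ c k : ℂˣ) : ℂ) = ZMod.stdAddChar (tau i₀ c k) := rfl

/-- `σ_c(1 + e ⊗ φ) = 1 ⇒ φ(c) = 0` (`ψ` takes the value `1` only at `0`). -/
theorem dotProduct_eq_zero_of_trChar_eq_one (c : Fin m → ZMod p) {φ : Fin m → ZMod p}
    (hφ : φ i₀ = 0) (h : trChar i₀ c ⟨transl i₀ φ hφ, transl_mem i₀ φ hφ⟩ = 1) : φ ⬝ᵥ c = 0 := by
  haveI : NeZero p := ⟨hp.out.ne_zero⟩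
  have h' : (ZMod.stdAddChar (tau i₀ c ⟨transl i₀ φ hφ, transl_mem i₀ φ hφ⟩) : ℂ) = 1 := by
    rw [← coe_trChar, h, Units.val_one]
  rw [tau_eq i₀ c (coe_transl i₀ φ hφ)] at h'
  exact ((ZMod.isPrimitive_stdAddChar p).zmod_char_eq_one_iff p _).mp h'

/-- **Admissibility test.**  If `u` is `σ_c`-admissible for `T(𝔽_p e_{i₀})`, then every functional
`φ` with `φ(e_{i₀}) = 0` and `φ(u) = 0` satisfies `φ(c) = 0` (i.e. `c ∈ ⟨e_{i₀}, u⟩`). -/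
theorem adm_test {c u : Fin m → ZMod p} (hu : u ∈ adm (translGroup i₀) (trChar i₀ c))
    {φ : Fin m → ZMod p} (hφ : φ i₀ = 0) (hφu : φ ⬝ᵥ u = 0) : φ ⬝ᵥ c = 0 :=
  dotProduct_eq_zero_of_trChar_eq_one i₀ c hφ
    (mem_adm.1 hu ⟨transl i₀ φ hφ, transl_mem i₀ φ hφ⟩ (transl_smul_of_eq_zero i₀ φ hφ hφu))

end Transvections

section Disjoint

variable {i₀ i₁ i₂ : Fin m}

/-- **Disjoint admissible sets.**  For distinct `i₀, i₁, i₂`: the admissible set of `σ_{e_{i₂}}` on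
`T(𝔽_p e_{i₀})` (inside `⟨e_{i₀}, e_{i₂}⟩ ∖ 𝔽_p e_{i₀}`) and that of `σ_{e_{i₀}}` on `T(𝔽_p e_{i₁})`
(inside `⟨e_{i₁}, e_{i₀}⟩ ∖ 𝔽_p e_{i₁}`) do not meet. -/
theorem disjoint_adm_transl (h01 : i₀ ≠ i₁) (h02 : i₀ ≠ i₂) (h12 : i₁ ≠ i₂) :
    Disjoint (adm (translGroup i₀) (trChar i₀ (Pi.single i₂ (1 : ZMod p))))
      (adm (translGroup i₁) (trChar i₁ (Pi.single i₀ (1 : ZMod p)))) := by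
  refine Set.disjoint_left.2 fun w hw₁ hw₂ => ?_
  by_cases hw : w i₂ = 0
  · -- test `T(e_{i₀})` with `φ = e_{i₂}^*`: `φ(w) = w_{i₂} = 0` but `φ(e_{i₂}) = 1`
    have h := adm_test i₀ hw₁ (φ := Pi.single i₂ (1 : ZMod p))
      (by rw [Pi.single_eq_of_ne h02]) (by rw [single_dotProduct, one_mul, hw])
    rw [single_dotProduct, one_mul, Pi.single_eq_same] at h
    exact one_ne_zero h
  · -- test `T(e_{i₁})` with `φ = e_{i₀}^* − (w_{i₀}/w_{i₂}) e_{i₂}^*`: `φ(w) = 0` but `φ(e_{i₀}) = 1`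
    set φ : Fin m → ZMod p := Pi.single i₀ 1 - (w i₀ * (w i₂)⁻¹) • Pi.single i₂ 1 with hφdef
    have hφ1 : φ i₁ = 0 := by
      rw [hφdef, Pi.sub_apply, Pi.smul_apply, Pi.single_eq_of_ne (Ne.symm h01),
        Pi.single_eq_of_ne h12, smul_zero, sub_zero]
    have hφw : φ ⬝ᵥ w = 0 := by
      rw [hφdef, sub_dotProduct, smul_dotProduct, single_dotProduct, single_dotProduct, one_mul,
        one_mul, smul_eq_mul, mul_assoc, inv_mul_cancel₀ hw, mul_one, sub_self]
    have h := adm_test i₁ hw₂ hφ1 hφw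
    rw [dotProduct_single, mul_one, hφdef, Pi.sub_apply, Pi.smul_apply, Pi.single_eq_same,
      Pi.single_eq_of_ne h02, smul_zero, sub_zero] at h
    exact one_ne_zero h

end Disjoint

section Exclusion

variable {H₁ H₂ H₃ : Subgroup (GLm p m)} {i₀ i₁ i₂ : Fin m}

/-- The subgroup TPP restricts to subgroups of the members. -/
theorem subgroupTPP_mono {G : Type*} [Group G] {L₁ L₂ L₃ K₁ K₂ K₃ : Subgroup G}
    (htpp : SubgroupTPP L₁ L₂ L₃) (h₁ : K₁ ≤ L₁) (h₂ : K₂ ≤ L₂) (h₃ : K₃ ≤ L₃) :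
    SubgroupTPP K₁ K₂ K₃ :=
  fun a ha b hb c hc => htpp a (h₁ ha) b (h₂ hb) c (h₃ hc)

/-- **TRANSVECTION PAIR EXCLUSION, members 1–2.**  For distinct coordinates `i₀, i₁, i₂` (so
`m ≥ 3`): if `H₁ ⊇ T(𝔽_p e_{i₀})` and `H₂ ⊇ T(𝔽_p e_{i₁})`, a subgroup-TPP triple `(H₁, H₂, H₃)`
carries no level-one identity design — every `p`, every exponent, `H₃` arbitrary. -/
theorem no_design_of_transl₁₂ (h01 : i₀ ≠ i₁) (h02 : i₀ ≠ i₂) (h12 : i₁ ≠ i₂)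
    (htpp : SubgroupTPP H₁ H₂ H₃) (hK₁ : translGroup i₀ ≤ H₁) (hK₂ : translGroup i₁ ≤ H₂) :
    ¬ ∃ c : Mat p m → ℂ, (∀ M, 1 < M.rank → c M = 0) ∧
      (∑ M, c M * ZMod.stdAddChar (Matrix.trace (M * ((1 : GLm p m) : Mat p m)))) = 1 ∧
      ∀ a ∈ H₁, ∀ b ∈ H₂, ∀ g ∈ H₃, a * b * g ≠ 1 →
        (∑ M, c M * ZMod.stdAddChar (Matrix.trace (M * ((a * b * g : GLm p m) : Mat p m)))) = 0 := by
  rintro ⟨c, hc, h1, h0⟩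
  exact no_design_of_disjoint₁₂ (subgroupTPP_mono htpp hK₁ hK₂ le_rfl) _ _
    (disjoint_adm_transl h01 h02 h12)
    ⟨c, hc, h1, fun a ha b hb g hg hne => h0 a (hK₁ ha) b (hK₂ hb) g hg hne⟩

/-- **TRANSVECTION PAIR EXCLUSION, members 2–3.** -/
theorem no_design_of_transl₂₃ (h01 : i₀ ≠ i₁) (h02 : i₀ ≠ i₂) (h12 : i₁ ≠ i₂)
    (htpp : SubgroupTPP H₁ H₂ H₃) (hK₂ : translGroup i₀ ≤ H₂) (hK₃ : translGroup i₁ ≤ H₃) :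
    ¬ ∃ c : Mat p m → ℂ, (∀ M, 1 < M.rank → c M = 0) ∧
      (∑ M, c M * ZMod.stdAddChar (Matrix.trace (M * ((1 : GLm p m) : Mat p m)))) = 1 ∧
      ∀ a ∈ H₁, ∀ b ∈ H₂, ∀ g ∈ H₃, a * b * g ≠ 1 →
        (∑ M, c M * ZMod.stdAddChar (Matrix.trace (M * ((a * b * g : GLm p m) : Mat p m)))) = 0 := by
  rintro ⟨c, hc, h1, h0⟩
  exact no_design_of_disjoint₂₃ (subgroupTPP_mono htpp le_rfl hK₂ hK₃) _ _
    (disjoint_adm_transl h01 h02 h12)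
    ⟨c, hc, h1, fun a ha b hb g hg hne => h0 a ha b (hK₂ hb) g (hK₃ hg) hne⟩

end Exclusion

end TransvectionPair
end Summit.MatrixMultiplication.MatrixMultiplication.Theorems.SubgroupIdentityDesigns.Negative
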